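import Mathlib
import Summits.MatrixMultiplication.MatrixMultiplication.Theorems.SnSubsetDichotomyHyperoctahedralThresholdStubGoodTwin

/-!
# The pointwise twin SUPPLY (pigeonhole on rungs) — crux `SnSubsetDichotomy.HyperoctahedralThreshold`
# (stmt-MatrixMultiplication-10883), refutation line `refutation_local_symmetry`, open core `stub_poorRigidCore`

Helper (`--supports`) for the open core of the line.  Vocabulary of the line: `μ 0, μ 1, μ 2` are
fixed-point-free involutions of `Fin n` (three perfect matchings), colour words `w : List (Fin 3)` act on the
right, `x · w := w.foldl (fun v c => μ c v) x`; a word is REDUCED when `List.IsChain (· ≠ ·) w` and CYCLICALLY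
REDUCED when `List.IsChain (· ≠ ·) (w ++ w)`; a RUNG is a pair of distinct points; a TWIN PRE-PAIR is a cyclically
reduced non-empty word `z` together with two distinct fixed points, i.e. a closed non-backtracking colour-walk of
the rung graph of twin type (crux NOTES §2 (S-twin), §9 (S2)).

Main results (no hypothesis on the host beyond `μ c * μ c = 1` and fixed-point-freeness; no spectral input):

* `TwinSupply.exists_reducedWords` — an explicit injection of `Fin 3 × (Fin L → Fin 2)` (cardinal `3 · 2 ^ L`) into the
  reduced words of length `L + 1`.
* `TwinSupply.cyclic_of_closed` — a non-empty reduced word closing at two points conjugates to a cyclically reduced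
  non-empty word closing at the two transported points (strip equal end letters; a single letter cannot close by
  fixed-point-freeness).
* `TwinSupply.cyclic_of_collision` — two DISTINCT reduced words with the same action on two points yield the same
  (strip the common suffix, then the common prefix, then close up `t ++ t'.reverse`).
* `supply_twinPrePair` — **(S2) of the crux NOTES, pointwise**: if `n * n < 3 * 2 ^ L` then for EVERY two points
  `p, q` there are words `u, z`, `z ≠ []` cyclically reduced, `|z| + 2|u| ≤ 2 (L + 1)`, with `z` fixing `p · u` and
  `q · u` (pigeonhole: the `3 · 2 ^ L` reduced words of length `L + 1` cannot act injectively into `Fin n × Fin n`).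
* `supply_closedRungWalk` — the same in the format of the core's conclusion: every rung `{x, y}` is joined by a rung
  path of length `≤ L + 1` to a rung lying on a closed colour-walk of the rung graph with `k + 1 ≤ 2 (L + 1)` rungs,
  side-preserving steps, distinct rung ends and cyclically non-backtracking colours — i.e. everything the conclusion of
  `stub_poorRigidCore` asks except R-avoidance and the equal-or-disjoint (cleanness) clause, which are the open part.

This is the twin ("per rung", existence) form of the SUPPLY half of the supply/defect bookkeeping of the line (crux
NOTES §§9, 11, 12.3); the counting form for same-colour REFLECTION structures is the sibling
`…StubSameColourSupply` (lead c3, p112303).  The landed bricks `stub_goodTwin`, `stub_patternTwin`, `stub_patternRefl`,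
`stub_slideBound`, `stub_globalHarvest` consume closed rung walks; this file produces one next to every rung, with the
free/cyclic reduction done once and for all in the line's `List`/`foldl` vocabulary. [folklore; this line]
-/

set_option linter.dupNamespace false

namespace Summit.MatrixMultiplication.MatrixMultiplication.Theorems.HyperoctahedralThreshold

open Equiv

namespace TwinSupply

variable {n : ℕ}

/-- Appending one letter acts by that letter last. -/
theorem foldl_act_concat (μ : Fin 3 → Perm (Fin n)) (x : Fin n) (t : List (Fin 3)) (e : Fin 3) :
    (t ++ [e]).foldl (fun v c => μ c v) x = μ e (t.foldl (fun v c => μ c v) x) := by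
  rw [List.foldl_concat]

/-- An involution letter undoes itself (local copy of a one-liner of the sibling files). -/
private theorem inv_apply (μ : Fin 3 → Perm (Fin n)) (hμ : ∀ c, μ c * μ c = 1) (c : Fin 3) (v : Fin n) :
    μ c (μ c v) = v := by
  have : (μ c * μ c) v = v := by rw [hμ c]; rfl
  simpa using this

/-- Walking back along the reversed word undoes the walk (letters are involutions); cf. the identical
`Rotation.foldl_act_reverse` / `Supply.foldl_act_reverse` of the sibling files, a private copy to keep this file
import-light (those modules post-date the farm snapshot this file was checked against). -/
private theorem foldl_act_reverse (μ : Fin 3 → Perm (Fin n)) (hμ : ∀ c, μ c * μ c = 1) :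
    ∀ (w : List (Fin 3)) (x : Fin n),
      w.reverse.foldl (fun v c => μ c v) (w.foldl (fun v c => μ c v) x) = x := by
  intro w
  induction w with
  | nil => intro x; rfl
  | cons c w ih =>
    intro x
    rw [List.foldl_cons, List.reverse_cons, List.foldl_append, ih]
    exact inv_apply μ hμ c x

/-- A reduced word whose first and last letters differ is cyclically reduced. -/
theorem isChain_append_self {z : List (Fin 3)} (hz : List.IsChain (· ≠ ·) z)
    (h : ∀ x ∈ z.getLast?, ∀ y ∈ z.head?, x ≠ y) : List.IsChain (· ≠ ·) (z ++ z) :=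
  List.isChain_append.2 ⟨hz, hz, h⟩

/-- **Cyclic reduction.**  A non-empty reduced word `t` closing at `p` and at `q` (for fixed-point-free
involutions) conjugates to a non-empty CYCLICALLY reduced word `z` closing at `p · u` and `q · u`, with
`|z| + 2 |u| ≤ |t|`: strip equal end letters `t = d m d` (the closures transport along `d`); a single letter
never closes. -/
theorem cyclic_of_closed (μ : Fin 3 → Perm (Fin n)) (hμ : ∀ c, μ c * μ c = 1) (hfpf : ∀ c v, μ c v ≠ v) :
    ∀ (N : ℕ) (t : List (Fin 3)) (p q : Fin n), t.length ≤ N → t ≠ [] → List.IsChain (· ≠ ·) t →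
      t.foldl (fun v c => μ c v) p = p → t.foldl (fun v c => μ c v) q = q →
      ∃ u z : List (Fin 3), z ≠ [] ∧ List.IsChain (· ≠ ·) (z ++ z) ∧ z.length + 2 * u.length ≤ t.length ∧
        z.foldl (fun v c => μ c v) (u.foldl (fun v c => μ c v) p) = u.foldl (fun v c => μ c v) p ∧
        z.foldl (fun v c => μ c v) (u.foldl (fun v c => μ c v) q) = u.foldl (fun v c => μ c v) q := by
  intro N
  induction N with
  | zero =>
    intro t p q hN ht
    exact absurd (List.eq_nil_of_length_eq_zero (Nat.le_zero.1 hN)) ht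
  | succ N ih =>
    intro t p q hN ht hc hp hq
    obtain ⟨d, t₁, rfl⟩ := List.exists_cons_of_ne_nil ht
    rcases List.eq_nil_or_concat t₁ with h1 | ⟨m, e, h1⟩
    · subst h1
      exact absurd hp (hfpf d p)
    · rw [List.concat_eq_append] at h1
      subst h1
      by_cases hde : d = e
      · subst hde
        -- `t = d :: (m ++ [d])`: strip both ends and recurse on `m` at the transported points
        have hm : m ≠ [] := by
          rintro rfl
          have := hc
          simp at this
        have hcm : List.IsChain (· ≠ ·) m :=
          (List.isChain_cons.1 hc).2.left_of_append
        have key : ∀ r : Fin n, (d :: (m ++ [d])).foldl (fun v c => μ c v) r = r →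
            m.foldl (fun v c => μ c v) (μ d r) = μ d r := by
          intro r hr
          rw [List.foldl_cons, foldl_act_concat] at hr
          have := congrArg (μ d) hr
          rwa [inv_apply μ hμ] at this
        have hlen : m.length ≤ N := by
          simp only [List.length_cons, List.length_append] at hN
          omega
        obtain ⟨u, z, hz0, hzc, hzl, hzp, hzq⟩ := ih m (μ d p) (μ d q) hlen hm hcm (key p hp) (key q hq)
        refine ⟨d :: u, z, hz0, hzc, ?_, ?_, ?_⟩
        · simp only [List.length_cons, List.length_append]
          omega
        · simpa only [List.foldl_cons] using hzp
        · simpa only [List.foldl_cons] using hzq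
      · -- first and last letters differ: `t` itself is cyclically reduced
        refine ⟨[], d :: (m ++ [e]), by simp, ?_, by simp, by simpa using hp, by simpa using hq⟩
        refine isChain_append_self hc ?_
        intro x hx y hy
        rw [← List.cons_append, List.getLast?_concat, Option.mem_def, Option.some.injEq] at hx
        rw [List.head?_cons, Option.mem_def, Option.some.injEq] at hy
        rw [← hx, ← hy]
        exact fun h => hde h.symm

/-- **Collision ⇒ twin pre-pair.**  Two DISTINCT reduced words `t ≠ t'` acting identically on `p` and on `q`
yield a non-empty cyclically reduced `z` closing at `p · u` and `q · u` with `|z| + 2 |u| ≤ |t| + |t'|`: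
strip the common suffix (letters are injective), strip the common prefix (transporting the base points),
and when both ends differ close up `z := t ++ t'.reverse`; if one word is exhausted the other closes at
`p, q` and `cyclic_of_closed` applies. -/
theorem cyclic_of_collision (μ : Fin 3 → Perm (Fin n)) (hμ : ∀ c, μ c * μ c = 1)
    (hfpf : ∀ c v, μ c v ≠ v) :
    ∀ (N : ℕ) (t t' : List (Fin 3)) (p q : Fin n), t.length + t'.length ≤ N → t ≠ t' →
      List.IsChain (· ≠ ·) t → List.IsChain (· ≠ ·) t' →
      t.foldl (fun v c => μ c v) p = t'.foldl (fun v c => μ c v) p →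
      t.foldl (fun v c => μ c v) q = t'.foldl (fun v c => μ c v) q →
      ∃ u z : List (Fin 3), z ≠ [] ∧ List.IsChain (· ≠ ·) (z ++ z) ∧
        z.length + 2 * u.length ≤ t.length + t'.length ∧
        z.foldl (fun v c => μ c v) (u.foldl (fun v c => μ c v) p) = u.foldl (fun v c => μ c v) p ∧
        z.foldl (fun v c => μ c v) (u.foldl (fun v c => μ c v) q) = u.foldl (fun v c => μ c v) q := by
  intro N
  induction N with
  | zero =>
    intro t t' p q hN htt
    have h1 : t = [] := List.eq_nil_of_length_eq_zero (by omega)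
    have h2 : t' = [] := List.eq_nil_of_length_eq_zero (by omega)
    exact absurd (h1.trans h2.symm) htt
  | succ N ih =>
    intro t t' p q hN htt hc hc' hp hq
    -- one of the two words exhausted: the other closes at `p` and `q`
    by_cases ht0 : t = []
    · subst ht0
      have ht' : t' ≠ [] := fun h => htt h.symm
      obtain ⟨u, z, h1, h2, h3, h4, h5⟩ :=
        cyclic_of_closed μ hμ hfpf (N + 1) t' p q (by simpa using hN) ht' hc' hp.symm hq.symm
      exact ⟨u, z, h1, h2, by simpa using h3, h4, h5⟩
    by_cases ht0' : t' = []
    · subst ht0'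
      obtain ⟨u, z, h1, h2, h3, h4, h5⟩ :=
        cyclic_of_closed μ hμ hfpf (N + 1) t p q (by simpa using hN) ht0 hc hp hq
      exact ⟨u, z, h1, h2, by simpa using h3, h4, h5⟩
    -- both non-empty: compare last letters
    obtain ⟨t₂, e, hte⟩ : ∃ t₂ e, t = t₂ ++ [e] := by
      rcases List.eq_nil_or_concat t with h | ⟨t₂, e, h⟩
      · exact absurd h ht0
      · exact ⟨t₂, e, by rw [h, List.concat_eq_append]⟩
    obtain ⟨t₂', e', hte'⟩ : ∃ t₂' e', t' = t₂' ++ [e'] := by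
      rcases List.eq_nil_or_concat t' with h | ⟨t₂', e', h⟩
      · exact absurd h ht0'
      · exact ⟨t₂', e', by rw [h, List.concat_eq_append]⟩
    by_cases hee : e = e'
    · subst hee hte hte'
      have strip : ∀ r : Fin n, (t₂ ++ [e]).foldl (fun v c => μ c v) r = (t₂' ++ [e]).foldl (fun v c => μ c v) r →
          t₂.foldl (fun v c => μ c v) r = t₂'.foldl (fun v c => μ c v) r := by
        intro r hr
        rw [foldl_act_concat, foldl_act_concat] at hr
        exact (μ e).injective hr
      have hne : t₂ ≠ t₂' := fun h => htt (by rw [h])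
      have hlen : t₂.length + t₂'.length ≤ N := by
        simp only [List.length_append, List.length_singleton] at hN; omega
      obtain ⟨u, z, h1, h2, h3, h4, h5⟩ := ih t₂ t₂' p q hlen hne hc.left_of_append hc'.left_of_append
        (strip p hp) (strip q hq)
      exact ⟨u, z, h1, h2, by simp only [List.length_append, List.length_singleton]; omega, h4, h5⟩
    -- last letters differ: compare first letters
    obtain ⟨d, t₁, htd⟩ := List.exists_cons_of_ne_nil ht0
    obtain ⟨d', t₁', htd'⟩ := List.exists_cons_of_ne_nil ht0'
    by_cases hdd : d = d'
    · subst hdd htd htd'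
      rw [List.foldl_cons, List.foldl_cons] at hp hq
      have hne : t₁ ≠ t₁' := fun h => htt (by rw [h])
      have hlen : t₁.length + t₁'.length ≤ N := by
        simp only [List.length_cons] at hN; omega
      obtain ⟨u, z, h1, h2, h3, h4, h5⟩ := ih t₁ t₁' (μ d p) (μ d q) hlen hne
        (List.isChain_cons.1 hc).2 (List.isChain_cons.1 hc').2 hp hq
      refine ⟨d :: u, z, h1, h2, ?_, by simpa only [List.foldl_cons] using h4,
        by simpa only [List.foldl_cons] using h5⟩
      simp only [List.length_cons]; omega
    -- both ends differ: close up `z := t ++ t'.reverse`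
    have hrev : ∀ r : Fin n, t.foldl (fun v c => μ c v) r = t'.foldl (fun v c => μ c v) r →
        (t ++ t'.reverse).foldl (fun v c => μ c v) r = r := by
      intro r hr
      rw [List.foldl_append, hr]
      exact foldl_act_reverse μ hμ t' r
    refine ⟨[], t ++ t'.reverse, by simp [ht0], ?_, by simp, by simpa using hrev p hp,
      by simpa using hrev q hq⟩
    have hcr : List.IsChain (· ≠ ·) t'.reverse :=
      List.isChain_reverse.2 (hc'.imp fun a b h => fun h' => h h'.symm)
    have hz : List.IsChain (· ≠ ·) (t ++ t'.reverse) := by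
      refine List.isChain_append.2 ⟨hc, hcr, ?_⟩
      intro x hx y hy
      rw [hte, List.getLast?_concat] at hx
      rw [List.head?_reverse, hte', List.getLast?_concat] at hy
      simp only [Option.mem_def, Option.some.injEq] at hx hy
      subst hx; subst hy
      exact hee
    refine isChain_append_self hz ?_
    intro x hx y hy
    have ht'r : t'.reverse ≠ [] := by simpa using ht0'
    rw [List.getLast?_append_of_ne_nil _ ht'r, List.getLast?_reverse, htd', List.head?_cons] at hx
    rw [List.head?_append, htd, List.head?_cons, Option.some_or] at hy
    simp only [Option.mem_def, Option.some.injEq] at hx hy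
    subst hx; subst hy
    exact fun h => hdd h.symm

/-- **Reduced words are many.**  An explicit injection of `Fin 3 × (Fin L → Fin 2)` into the reduced
colour words of length `L + 1`: first letter `c₀`, and each further letter is one of the two letters
different from its predecessor (`Fin.succAbove`). -/
theorem exists_reducedWords (L : ℕ) : ∃ F : Fin 3 × (Fin L → Fin 2) → List (Fin 3),
    Function.Injective F ∧ ∀ cb, List.IsChain (· ≠ ·) (F cb) ∧ (F cb).length = L + 1 := by
  -- the letter sequence, on `ℕ`
  let W : Fin 3 × (Fin L → Fin 2) → ℕ → Fin 3 := fun cb i =>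
    Nat.rec (motive := fun _ => Fin 3) cb.1
      (fun j prev => Fin.succAbove prev (if h : j < L then cb.2 ⟨j, h⟩ else 0)) i
  have hW0 : ∀ cb, W cb 0 = cb.1 := fun cb => rfl
  have hWs : ∀ cb j, W cb (j + 1) = Fin.succAbove (W cb j) (if h : j < L then cb.2 ⟨j, h⟩ else 0) :=
    fun cb j => rfl
  refine ⟨fun cb => List.ofFn (fun i : Fin (L + 1) => W cb i), ?_, ?_⟩
  · intro cb cb' h
    have hfun : (fun i : Fin (L + 1) => W cb i) = (fun i : Fin (L + 1) => W cb' i) :=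
      List.ofFn_injective h
    have hpt : ∀ i, i ≤ L → W cb i = W cb' i := fun i hi =>
      congrFun hfun ⟨i, Nat.lt_succ_of_le hi⟩
    have h1 : cb.1 = cb'.1 := by rw [← hW0 cb, ← hW0 cb']; exact hpt 0 (Nat.zero_le _)
    have h2 : cb.2 = cb'.2 := by
      funext ⟨j, hj⟩
      have := hpt (j + 1) hj
      rw [hWs, hWs, hpt j hj.le] at this
      have := Fin.succAbove_right_injective this
      simpa [hj] using this
    exact Prod.ext h1 h2
  · intro cb
    refine ⟨?_, by simp⟩
    rw [List.isChain_iff_getElem]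
    intro i hi
    simp only [List.length_ofFn] at hi
    simp only [List.getElem_ofFn]
    rw [hWs]
    exact (Fin.succAbove_ne _ _).symm

end TwinSupply

/-- **The pointwise twin supply (S2).**  For fixed-point-free involutions `μ 0, μ 1, μ 2` of `Fin n` and
`n * n < 3 * 2 ^ L`: for EVERY two points `p, q` there are colour words `u` and `z`, `z ≠ []` cyclically reduced,
`|z| + 2 |u| ≤ 2 (L + 1)`, such that `z` closes at `p · u` and at `q · u` — a twin pre-pair within rung-distance
`|u|` of the rung `{p, q}` (for `p ≠ q` the two fixed points are distinct, `z` acting injectively).  Proof: the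
`3 · 2 ^ L` reduced words of length `L + 1` (`TwinSupply.exists_reducedWords`) map `w ↦ (p · w, q · w)` into
`Fin n × Fin n`, so two distinct ones collide (pigeonhole), and `TwinSupply.cyclic_of_collision` reduces the collision.
Crux NOTES §9 (S2); with `L = ⌈2 log₂ n − log₂ 3⌉` the closed walk has length `≤ 4 log₂ n + O(1)`.
[folklore; this line] -/
theorem supply_twinPrePair (n L : ℕ) (μ : Fin 3 → Equiv.Perm (Fin n)) (hμ : ∀ c, μ c * μ c = 1)
    (hfpf : ∀ c v, μ c v ≠ v) (hL : n * n < 3 * 2 ^ L) (p q : Fin n) :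
    ∃ u z : List (Fin 3), z ≠ [] ∧ List.IsChain (· ≠ ·) (z ++ z) ∧ z.length + 2 * u.length ≤ 2 * (L + 1) ∧
      z.foldl (fun v c => μ c v) (u.foldl (fun v c => μ c v) p) = u.foldl (fun v c => μ c v) p ∧
      z.foldl (fun v c => μ c v) (u.foldl (fun v c => μ c v) q) = u.foldl (fun v c => μ c v) q := by
  obtain ⟨F, hF, hF'⟩ := TwinSupply.exists_reducedWords L
  have hcard : Fintype.card (Fin n × Fin n) < Fintype.card (Fin 3 × (Fin L → Fin 2)) := by
    simpa using hL
  obtain ⟨cb, cb', hne, hcoll⟩ := Fintype.exists_ne_map_eq_of_card_lt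
    (fun cb => ((F cb).foldl (fun v c => μ c v) p, (F cb).foldl (fun v c => μ c v) q)) hcard
  simp only [Prod.mk.injEq] at hcoll
  have hne' : F cb ≠ F cb' := fun h => hne (hF h)
  obtain ⟨u, z, h1, h2, h3, h4, h5⟩ := TwinSupply.cyclic_of_collision μ hμ hfpf _ (F cb) (F cb') p q le_rfl hne'
    (hF' cb).1 (hF' cb').1 hcoll.1 hcoll.2
  refine ⟨u, z, h1, h2, ?_, h4, h5⟩
  rw [(hF' cb).2, (hF' cb').2] at h3
  omega

open GoodTwin in
/-- **The supply in the format of the core's conclusion.**  For fixed-point-free involutions `μ c` of `Fin n`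
and `n * n < 3 * 2 ^ L`, every rung `{x, y}` (`x ≠ y`) is joined by a colour word `u` to the base rung of a
closed colour-walk of the rung graph in the vocabulary of `stub_poorRigidCore`'s conclusion: `k + 1` rungs
`(p i, q i)` indexed cyclically by `Fin (k + 1)` with `p i ≠ q i`, the step of colour `col i` carrying rung `i`
onto rung `i + 1` side-preservingly, consecutive colours distinct (cyclically), `p 0 = x · u`, `q 0 = y · u`, and
`(k + 1) + 2 |u| ≤ 2 (L + 1)`.  Only R-avoidance and the equal-or-disjoint clause of the core are missing — they are
its open content.  Construction: `supply_twinPrePair` gives `(u, z)`; put `k + 1 := |z|`, `p t := x · u · z.take t`,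
`q t := y · u · z.take t`, `col t := z[t]` (`GoodTwin.foldl_take_step`, `GoodTwin.cyclic_ne`). [this line] -/
theorem supply_closedRungWalk (n L : ℕ) (μ : Fin 3 → Equiv.Perm (Fin n)) (hμ : ∀ c, μ c * μ c = 1)
    (hfpf : ∀ c v, μ c v ≠ v) (hL : n * n < 3 * 2 ^ L) (x y : Fin n) (hxy : x ≠ y) :
    ∃ (u : List (Fin 3)) (k : ℕ) (p q : Fin (k + 1) → Fin n) (col : Fin (k + 1) → Fin 3),
      (∀ i, p i ≠ q i) ∧ (∀ i, μ (col i) (p i) = p (i + 1) ∧ μ (col i) (q i) = q (i + 1)) ∧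
      (∀ i, col i ≠ col (i + 1)) ∧ p 0 = u.foldl (fun v c => μ c v) x ∧ q 0 = u.foldl (fun v c => μ c v) y ∧
      (k + 1) + 2 * u.length ≤ 2 * (L + 1) := by
  obtain ⟨u, z, hz0, hzc, hzl, hzp, hzq⟩ := supply_twinPrePair n L μ hμ hfpf hL x y
  set x' := u.foldl (fun v c => μ c v) x with hx'
  set y' := u.foldl (fun v c => μ c v) y with hy'
  have hℓ : 1 ≤ z.length := Nat.one_le_iff_ne_zero.2 (fun h => hz0 (List.eq_nil_of_length_eq_zero h))
  obtain ⟨k, hk⟩ : ∃ k, z.length = k + 1 := ⟨z.length - 1, by omega⟩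
  refine ⟨u, k, fun t => (z.take (t : ℕ)).foldl (fun v c => μ c v) x',
    fun t => (z.take (t : ℕ)).foldl (fun v c => μ c v) y',
    fun t => z[(t : ℕ)]'(by omega), ?_, ?_, ?_, by simp [hx'], by simp [hy'], by omega⟩
  · intro t h
    exact hxy (foldl_injective μ u (foldl_injective μ _ h))
  · intro t
    have ht : (t : ℕ) < z.length := by omega
    have hval : ((t + 1 : Fin (k + 1)) : ℕ) = ((t : ℕ) + 1) % z.length := by
      rw [Fin.val_add, hk]
      simp
    refine ⟨?_, ?_⟩
    · rw [foldl_take_step μ z x' hzp t ht]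
      simp only [hval]
    · rw [foldl_take_step μ z y' hzq t ht]
      simp only [hval]
  · intro t
    have ht : (t : ℕ) < z.length := by omega
    have hval : ((t + 1 : Fin (k + 1)) : ℕ) = ((t : ℕ) + 1) % z.length := by
      rw [Fin.val_add, hk]
      simp
    exact cyclic_ne hzc t _ ht (by rw [hval]; exact Nat.mod_lt _ (by omega)) hval

/-- **Registered form (`stub_twinSupply`, `--supports` stmt-MatrixMultiplication-10883)** of
`supply_closedRungWalk`, stated as a closed `Prop` (all hypotheses as arrows): for fixed-point-free involutions
`μ c` of `Fin n` with `n * n < 3 * 2 ^ L`, every rung `{x, y}` is joined by a word `u` to the base rung of a closed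
colour-walk of the rung graph with `k + 1` rungs, distinct rung ends, side-preserving steps and cyclically
non-backtracking colours, `(k + 1) + 2 |u| ≤ 2 (L + 1)`. [this line] -/
theorem stub_twinSupply : ∀ (n L : ℕ) (μ : Fin 3 → Equiv.Perm (Fin n)), (∀ c, μ c * μ c = 1) → (∀ c v, μ c v ≠ v) → n * n < 3 * 2 ^ L → ∀ x y : Fin n, x ≠ y → ∃ (u : List (Fin 3)) (k : ℕ) (p q : Fin (k + 1) → Fin n) (col : Fin (k + 1) → Fin 3), (∀ i, p i ≠ q i) ∧ (∀ i, μ (col i) (p i) = p (i + 1) ∧ μ (col i) (q i) = q (i + 1)) ∧ (∀ i, col i ≠ col (i + 1)) ∧ p 0 = u.foldl (fun v c => μ c v) x ∧ q 0 = u.foldl (fun v c => μ c v) y ∧ (k + 1) + 2 * u.length ≤ 2 * (L + 1) :=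
  fun n L μ hμ hfpf hL x y hxy => supply_closedRungWalk n L μ hμ hfpf hL x y hxy

end Summit.MatrixMultiplication.MatrixMultiplication.Theorems.HyperoctahedralThreshold
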